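import Summits.BirchSwinnertonDyer.BirchSwinnertonDyer.Theorems.PrintCf2RamifiedOffTYZQFormDefs
import HarnessLib

/-!
# Crux `PrintCf2.RamifiedOffTYZOfFacts` (stmt-BirchSwinnertonDyer-20509), line `offtyz-v7`: DEFINITIONS for the EVEN square form and the EVEN Ω-form
# (LEAD cruxlead-20509 g13, cycle 14) — pure `𝔽₂`-matrix vocabulary over a prime tuple, no Galois objects, nothing asserted

Companion of `…QFormDefs` (p678378, the odd vocabulary `kerSum`, `blockPrimes`, `coblockWeight`, `blockRho`).  For `n = 2p₁⋯p_k ≡ 6 (mod 8)` the square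
motion `[g·g moves P(n)]` of TYZ's genus point is, by g8's even square formula read through the block laws (even blocks: the regime-free law
p743258/p743484; odd blocks `≡ 5`: `MoverBlockForm.sqMotion_eq_kerSum_dotProduct_bits`) and the cofactor parities `|𝓛(x)| ≡ det M(x)` (TYZ Thm 1.1 +
Smith rows 1–3 + Monsky), the value at the bits of `g` of `evenSquareFormMatrix p`; the conjectured EVEN Ω-IDENTITY (crux workfile
`Cruxes/RamifiedOffTYZOfFacts/Lines/offtyz_v7_EvenOmega.lean`, research statement, verified on 10135 tuples and by `native_decide` on seven) says it
equals `evenOmegaFormMatrix p` (adjugate of Monsky's even matrix).  This file only NAMES the two sides and their ingredients so that the identity and the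
closed-form reduction can be stated and proved in `Theorems/` files.  BSD is not proved by any of this.

* `blockSixMatrix p S` — `N_S = [[A_S + D₋₂, z_S], [0, 0]]` of the even block `2d_S`; `blockKappaSix`, `blockKappaSixInf` — its kernel sum read back on
  `Fin k` and at `√2`;
* `blockWeightEven`, `blockWeightOdd` — `det M_even`, `det M_odd` of a sub-block (parities of `|𝓛(2d_X)|`, `|𝓛(d_X)|`);
* `chainCoeff p T` — the total coefficient of an odd block `d_T ≡ 5 (mod 8)` over the level-2 and level-3 chains of the recursion;
* `evenSquareFormMatrix p`, `evenOmegaFormMatrix p` — the two sides, as functions of `(x_im, x_2, x) ∈ 𝔽₂ × 𝔽₂ × 𝔽₂^k`.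

References: [cite: TianYuanZhang2017, Thm. 1.1, §3.1 (p0011 L53–L73), Thm. 3.6 (1)(2), proof of Lemma 3.21 (p0020 L27–L63)];
[cite: HeathBrown1994SelmerCongruentII, Appendix (Monsky), typescript p. 39 L27–L33, p. 41 L20–L36]; [cite: Smith2016CongruentDensity, Thm. 2.2 rows 1–3];
[cite: Stevenhagen1995RedeiMatrices, §2].
-/

noncomputable section

open scoped Classical

open Finset Matrix Literature.NumberTheory.EllipticCurves.HeathBrown1994

set_option autoImplicit false

namespace Summit.BirchSwinnertonDyer.PrintCf2.EvenOmegaDefs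

/-- The `(m+1) × (m+1)` matrix `N_S = [[A_S + D₋₂, z_S], [0, 0]]` of the even block `2d_S` (rows: Frobenius bit vectors and a zero row).
[cite: HeathBrown1994SelmerCongruentII, Appendix (Monsky)] [cite: Stevenhagen1995RedeiMatrices, §2] -/
def blockSixMatrix {k : ℕ} (p : Fin k → ℕ) (S : Finset (Fin k)) :
    Matrix (Fin S.card ⊕ Unit) (Fin S.card ⊕ Unit) (ZMod 2) :=
  Matrix.fromBlocks (legendreMatrix (QForm.blockPrimes p S) + legendreDiagonal (QForm.blockPrimes p S) (-2))
    (Matrix.of fun j (_ : Unit) => addLegendreSym 2 (QForm.blockPrimes p S j))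
    (0 : Matrix Unit (Fin S.card) (ZMod 2)) (0 : Matrix Unit Unit (ZMod 2))

/-- `κ^S` read back on `Fin k` (zero outside `S`): the prime coordinates of the kernel sum of `N_S`. [folklore] -/
def blockKappaSix {k : ℕ} (p : Fin k → ℕ) (S : Finset (Fin k)) (i : Fin k) : ZMod 2 :=
  if h : i ∈ S then QForm.kerSum (blockSixMatrix p S) (Sum.inl ((S.orderIsoOfFin rfl).symm ⟨i, h⟩)) else 0

/-- `κ^S_∞`: the `√2`-coordinate of the kernel sum of `N_S`. [folklore] -/
def blockKappaSixInf {k : ℕ} (p : Fin k → ℕ) (S : Finset (Fin k)) : ZMod 2 :=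
  QForm.kerSum (blockSixMatrix p S) (Sum.inr ())

/-- `det M_even` of a sub-block (the parity of `|𝓛(2d_X)|` for `2d_X ≡ 2 (mod 8)`, Smith row 2; `1` on the empty block: `𝓛(2) = ±1`).
[cite: HeathBrown1994SelmerCongruentII, Appendix (Monsky)] [cite: Smith2016CongruentDensity, Thm. 2.2 row 2] -/
def blockWeightEven {k : ℕ} (p : Fin k → ℕ) (X : Finset (Fin k)) : ZMod 2 := (monskyMatrixEven (QForm.blockPrimes p X)).det

/-- `det M_odd` of a sub-block (the parity of `|𝓛(d_X)|` for `d_X ≡ 1, 3 (mod 8)`, Smith rows 1, 3).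
[cite: HeathBrown1994SelmerCongruentII, Appendix (Monsky)] [cite: Smith2016CongruentDensity, Thm. 2.2 rows 1, 3] -/
def blockWeightOdd {k : ℕ} (p : Fin k → ℕ) (X : Finset (Fin k)) : ZMod 2 := (monskyMatrixOdd (QForm.blockPrimes p X)).det

/-- **The chain coefficient `c_T`** of an odd block `d_T ≡ 5 (mod 8)`: sum over `T ⊊ W ⊆ S ⊆ univ` with `d_{Sᶜ} ≡ 1 (8)` (or `S = univ`), `d_W ≡ 7 (8)`,
`d_{S∖W} ≡ 1 (mod 4)`, `d_{W∖T} ≡ 3 (8)` of `det M_odd(Sᶜ)·det M_even(S∖W)·det M_odd(W∖T)`.  LEAD g13 law (verified 8525/8525):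
`c_T = [s(n/d_T) = 1]·⟨z, u¹(n/d_T)⟩`. [cite: TianYuanZhang2017, Thm. 1.1, Thm. 3.6 (2), §3.4] -/
def chainCoeff {k : ℕ} (p : Fin k → ℕ) (T : Finset (Fin k)) : ZMod 2 :=
  ∑ S : Finset (Fin k), ∑ W : Finset (Fin k),
    if T ⊆ W ∧ T ≠ W ∧ W ⊆ S ∧ (∏ i ∈ Sᶜ, p i) % 8 = 1 ∧ (∏ i ∈ W, p i) % 8 = 7 ∧ (∏ i ∈ S \ W, p i) % 4 = 1 ∧
        (∏ i ∈ W \ T, p i) % 8 = 3 then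
      blockWeightOdd p Sᶜ * blockWeightEven p (S \ W) * blockWeightOdd p (W \ T) else 0

/-- **The even square form, matrix side**: `Ψ_n(x_im, x_2, x)` = Σ over even blocks `2d_S` (`d_{Sᶜ} ≡ 1 (8)`, incl. `S = univ`) of
`det M_odd(Sᶜ)·[x_im + x_2 + Σ_S x_j = 0]·(Σ_{j∈S} κ^S_j x_j + κ^S_∞ x_2)` + Σ over odd blocks `d_T ≡ 5 (8)` of `c_T·[x_im + Σ_T x_j = 0]·(Σ_{j∈T} ρ^T_j x_j)`
(indicators written as `1 + linear form`, valid over `𝔽₂`). [cite: TianYuanZhang2017, §3.1, Thm. 3.6 (1)(2), proof of Lemma 3.21] -/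
def evenSquareFormMatrix {k : ℕ} (p : Fin k → ℕ) (xim x2 : ZMod 2) (x : Fin k → ZMod 2) : ZMod 2 :=
  (∑ S : Finset (Fin k), if (∏ i ∈ Sᶜ, p i) % 8 = 1 then
      blockWeightOdd p Sᶜ * (1 + xim + x2 + ∑ j ∈ S, x j) * (∑ j ∈ S, blockKappaSix p S j * x j + blockKappaSixInf p S * x2) else 0) +
  ∑ T : Finset (Fin k), if (∏ i ∈ T, p i) % 8 = 5 then
      chainCoeff p T * (1 + xim + ∑ j ∈ T, x j) * (∑ j ∈ T, QForm.blockRho p T j * x j) else 0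

/-- **The even Ω-form, matrix side** (right side of (★★)₆ on abstract bits). [cite: HeathBrown1994SelmerCongruentII, Appendix (Monsky)] -/
def evenOmegaFormMatrix {k : ℕ} (p : Fin k → ℕ) (xim x2 : ZMod 2) (x : Fin k → ZMod 2) : ZMod 2 :=
  let A : Fin k → ZMod 2 := fun j => (monskyMatrixEven p).adjugate (Sum.inl j) (Sum.inr j)
  let A' : Fin k → ZMod 2 := fun j => (monskyMatrixEven p).adjugate (Sum.inr j) (Sum.inl j)
  let t : Fin k → ZMod 2 := fun j => addLegendreSym (-1) (p j)
  let G : ZMod 2 := ∑ i, t i * A i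
  xim * (∑ j, (A j + A' j + G) * x j) + xim * x2 * (∑ j, t j * (A j + A' j)) + x2 * (∑ j, A j * x j) +
    ∑ a, ∑ b, (if a < b then (A a + A b) * x a * x b else 0)

end Summit.BirchSwinnertonDyer.PrintCf2.EvenOmegaDefs

end
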